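import Literature.NumberTheory.LFunctions.WeilGroundState
import HarnessLib

/-!
# The semilocal Weil form has discrete spectrum (Connes–Consani–Moscovici 2025, Thm. 3.6) — named fact,
# and existence of ground states as a consequence

Literature/NumberTheory/LFunctions. Connes–Consani–Moscovici, *Zeta spectral triples*, arXiv:2511.22755
(2025, unrefereed — `@[claim … "under-review"]`), §3.2: for every `λ > 1` the semilocal Weil quadratic form
`QW_λ` on `L²([λ⁻¹, λ], d*u)` is densely defined, lower bounded and closed (Prop. 3.3, from Connes–Consani [4]),
hence represented by a lower-bounded self-adjoint operator `A_λ` (3.23), and **Thm. 3.6: "The selfadjoint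
operator `A_λ` has discrete lower bounded spectrum."** By the equivalences they quote from Schmüdgen
(Prop. 3.5 = [12, Prop. 10.6]: (1) the embedding `(D[A], ‖·‖_{t_A}) → H` is compact ⇔ (2) compact resolvent
⇔ (4) purely discrete spectrum), Thm. 3.6 is equivalently the COMPACTNESS OF THE FORM EMBEDDING, which has an
operator-free sequential rendering on the form core of test functions: every `L²`-normalised sequence of test
functions on the window with bounded form values has an `L²`-convergent subsequence. That is what we vendor,
in the tree's additive normalisation (`u = e^t`, window `[λ⁻¹, λ] ↔ [−a, a]`, `a = log λ`, `L²(d*u) = L²(dt)`;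
`QW_λ ↔ Re weilQuadratic` up to the positive normalisation constants of [4], which do not affect compactness;
lower-boundedness in the tree is the PROVED `bddBelow_weilQuadratic_sphere_holds`).

* `ConnesConsaniMoscovici2025_thm_3_6` — the fact (sequential compact embedding ⇔ discrete spectrum).
* `ConnesConsaniMoscovici2025_thm_3_6.exists_isWeilGroundState` — PROVED consequence: for every window `a > 0`
  a ground state exists, `∃ u, IsWeilGroundState a u` (CCM25 p. 34: "its smallest eigenvalue — whose existence
  is ensured by Theorem 3.6"; Bombieri 2000 Thm. 3 proves existence of a minimiser directly): a minimising
  sequence (`exists_weilMinimizingSeq`, in the tree) has bounded form values, so a subsequence converges.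

This discreteness is also the input of the min–max renderings `WeilWindowSimpleEven` (hypothesis of
Connes–van Suijlekom Thm. 6.1) and of `Suzuki2026_thm_1_4` (Suzuki 2026 quotes Thm. 3.6 on p. 4).
Deliberately NOT here: the operator `A_λ` itself, Prop. 3.3 (closedness), and §5–§7 of the paper.

## References
* A. Connes, C. Consani, H. Moscovici, *Zeta spectral triples*, arXiv:2511.22755 (2025), §3.2, Prop. 3.5,
  Thm. 3.6; §8 (the two missing steps). (key `ConnesConsaniMoscovici2025`)
* K. Schmüdgen, *Unbounded self-adjoint operators on Hilbert space*, GTM 265 (2012), Prop. 10.6, Thm. 10.7.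
* E. Bombieri, Rend. Lincei (9) 11 (2000), §4 Thm. 3.
-/

noncomputable section

open Complex Filter Set MeasureTheory
open scoped Topology

namespace Literature.NumberTheory.LFunctions

/-- CLAIM (**Connes–Consani–Moscovici 2025, Thm. 3.6** with Prop. 3.5 (1)⇔(4), arXiv:2511.22755, unrefereed):
the self-adjoint operator of the semilocal Weil form on the window has DISCRETE lower-bounded spectrum,
equivalently the form-norm embedding into `L²` is COMPACT; sequentially on the form core of test functions:
for every window `a > 0`, every sequence of test functions `gₙ` with `tsupport gₙ ⊆ [−a, a]`, `∫ ‖gₙ‖² = 1`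
and `Re Q(gₙ)` bounded above has a subsequence converging in `L²` to some `u ∈ L²`. -/
@[claim "ConnesConsaniMoscovici2025" "under-review"]
def ConnesConsaniMoscovici2025_thm_3_6 : Prop :=
  ∀ a : ℝ, 0 < a → ∀ g : ℕ → ℝ → ℂ,
    (∀ n, IsWeilTest (g n) ∧ tsupport (g n) ⊆ Icc (-a) a ∧ ∫ t, ‖g n t‖ ^ 2 = (1 : ℝ)) →
    BddAbove (Set.range fun n => (weilQuadratic (g n)).re) →
      ∃ u : ℝ → ℂ, MemLp u 2 ∧ ∃ φ : ℕ → ℕ, StrictMono φ ∧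
        Tendsto (fun n => ∫ t, ‖g (φ n) t - u t‖ ^ 2) atTop (𝓝 0)

/-- **Existence of ground states** from the compactness fact: for every window `a > 0` there is `u` with
`IsWeilGroundState a u` (a minimising sequence exists by `exists_weilMinimizingSeq`; its form values converge,
hence are bounded; a subsequence converges in `L²`, and a subsequence of a minimising sequence is minimising).
CCM25, §8: "its smallest eigenvalue — whose existence is ensured by Theorem 3.6". [folklore] -/
theorem ConnesConsaniMoscovici2025_thm_3_6.exists_isWeilGroundState
    (h : ConnesConsaniMoscovici2025_thm_3_6) {a : ℝ} (ha : 0 < a) :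
    ∃ u : ℝ → ℂ, IsWeilGroundState a u := by
  obtain ⟨g, hg, hQ⟩ := exists_weilMinimizingSeq ha
  obtain ⟨u, hu, φ, hφ, hconv⟩ := h a ha g hg hQ.bddAbove_range
  exact ⟨u, hu, fun n => g (φ n), fun n => hg (φ n), hQ.comp hφ.tendsto_atTop, hconv⟩

end Literature.NumberTheory.LFunctions
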